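import Summits.QuantumFields.YangMills.Theorems.BalabanUVNodesN07JunctionBlockConstantDatum
import Summits.QuantumFields.YangMills.Theorems.BalabanUVNodesN07RecordCubeVfixTorusGauge
import Summits.QuantumFields.YangMills.Theorems.BalabanUVNodesN07Thm4RecordStructureSym152PhiEG
import Summits.QuantumFields.YangMills.Theorems.BalabanUVNodesN07NrmSymPhiOfCoverRow
import Summits.QuantumFields.YangMills.Theorems.BalabanUVNodesN07SymTauScheduleNumerics
import Summits.QuantumFields.YangMills.Theorems.BalabanUVNodesN07Thm4RecMemberOfCrown
import Literature.MathematicalPhysics.QuantumFieldTheory.Balaban1983to89.Node00.TorusCoverCubeRecordDentCells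
import Literature.MathematicalPhysics.QuantumFieldTheory.Balaban1983to89.Node00.LargeFieldReprOfRecord
import Literature.MathematicalPhysics.QuantumFieldTheory.Balaban1983to89.B8CrownU0PointwiseOscOfFacesRec
import Literature.MathematicalPhysics.QuantumFieldTheory.Balaban1983to89.B8CfgExpBondLetterRec
import Summits.QuantumFields.YangMills.Theorems.BalabanUVNodesN07JunctionHJPrelims
import HarnessLib

/-!
# N07 [B11] (= [15] = [Balaban1985Variational]) Sect. F — **THE JUNCTION's `hJ`, DISCHARGED MODULO DISPLAYED NUMERICS**: for every datum of the def of record (β′) `HThm4RecSym152PhiEG`,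
# the junction CHOOSES `(h, X, ω)` (INTENT-34), proves the pre-composed crown's two oscillation rows and the (152) budget rows, and — for the crown's output `u₀` (ALL its rows) and the
# door's `(u, A)` (door formula + rows 1–8 + (T2b)) — SUPPLIES row 9′ `NrmSymPhiOfRecord … (Ψ ε j) … u′ A` for the GLUED gauge `u′ = u` on `π″□₀`, `= h̄·w_s` off it (133′'s relaxed clause)

Cell `pub-ymgap`, width seat `pub-ymgap-dag-n07-w3` g14 (junction owner of the K0 road; (σ1) pen of record, director-ym №330; INTENT-35).  `--kind proof --supports stmt-QuantumFields-20541
--as helper` (K0⁷; count-neutral; 0 `def`).  [I] = [Balaban1987RG1]; [3] = [Balaban1985Averaging]; [6] = [Balaban1985RegularSpaces]; [15] = [Balaban1985Variational]; [III] = [Balaban1988Convergent].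

WHY.  dag-n07-e's ✓133′ `hThm4RecSym152PhiEG_of_junction_glued` reduces the def of record (β′) to `DatumCrownPhiAt` and ONE per-datum hypothesis `hJ`; THIS FILE PROVES `hJ` (its text, relaxed last clause of 133′) from 19 DISPLAYED NUMERIC ROWS `hnum` (= dag-n07-e ✓139b `hnum_of_smallness`'s conclusion), composing BY NAME: carriers (dag-n07-w6 `exists_residual_axialTower` at `symCd`; dag-n07-e ✓138 residual radial with `hvfix`), `τ_T = 1` on `T^{(j)}` (✓`iter_gaugeAct_of_isResidual`), the `(h, X, ω)` package (INTENT-34), the schedule (✓p758613), the face-level `hptu` of the crown's `u₀`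
(INTENT-33 + ✓136), `hu1` (FILE 40c), the per-cell row 9′ (✓p760822), the cell dictionary (✓p750394, no-dent rows from the collar) and the gluing (✓p748467).

WHAT IS PROVED (sorry-free; axioms standard).  ★★★ `hJ_holds` — the junction's `hJ` (133′ text VERBATIM) under `hnum` (the preliminaries — no-dent rows from the collar, a spare direction,
the guard row from one number — are `…N07JunctionHJPrelims`).
HONEST FRAMING: count-neutral helper; `hnum` (19 rows), `DatumCrownPhiAt`, the separated-run data are DISPLAYED; nothing of [I]∕[3]∕[6]∕[15]∕[III] asserted anew; `HThm4RecSym152PhiEG` is NOT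
discharged here (it follows from 133′ + `DatumCrownPhiAt` + `hnum`, all displayed); `HThm4Rec*` UNDISCHARGED; N05 ∕ N07 NOT discharged; K0⁷ ∕ K1⁹ NOT closed; counts unmoved; one finite 𝕋⁴
programme at fixed ε — R4 closes the conditional finite-𝕋⁴ rung `BalabanLadder.UV` only; the YM mass gap (Clay) is NOT proved by any of this; nothing continuum ∕ ℝ⁴ ∕ OS.  No `def`,
no `instance`, no `notation`, no `sorry`.

References: [15] (144) p. 300, (147)–(154) pp. 301–302; [6] Thm. 4 p. 88, Prop. 6 (1.130)–(1.138) p. 99, (1.29) p. 81, (1.135) p. 99; [3] (78)–(81) p. 30, (166)–(167) p. 44;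
[III] (2.1)–(2.2) p. 254, (2.5) p. 255; [I] (0.1) p. 251, (0.3)–(0.4) pp. 252–253, (0.11) p. 253, (0.21) p. 256.
-/

set_option autoImplicit false

noncomputable section

open scoped BigOperators Matrix.Norms.L2Operator

namespace Summit.QuantumFields.YangMills.BalabanUVNodes.N07JunctionHJ

open Literature.MathematicalPhysics.QuantumFieldTheory.Balaban1983to89
open Literature.MathematicalPhysics.QuantumFieldTheory.Balaban1983to89.Node00
open Literature.MathematicalPhysics.QuantumFieldTheory.Balaban1983to89.B12RegularSpaces111 (gaugeU expI grad)
open Literature.MathematicalPhysics.QuantumFieldTheory.Balaban1983to89.B15DeterminingSets (embIter)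
open B15Eq112TorusCover (cover)
open B14DomainGeom (Pt Within)
open B8Eq131Cubes (box cube tcube tLo tHi ctr)
open B8Eq131CubesRec (tcubeZ cubeZ bLoZ bHiZ)
open B8Eq131CubesRecDictionary (mem_cubeZ_iff_add_ctrShift)
open B6SectAOperatorsV1 (RE dsE)
open B7Prop1Explicit (e gaugeAct U1)
open B7Prop1Local (AgreeOn InBox)
open B7Prop2Explicit (unitaryUnits unitaryUnits_le_U1 c2')
open B7Prop2Rec (C0Z)
open B7Prop2SpecialUnitary (specialUnitaryUnits specialUnitaryUnits_le_unitaryUnits)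
open BlockAveragingZd (avgIterZ ctrShift)
open B8Ineq132 (covDerivFwd InAk BondTouches)
open B8Eq140Level (SideTouches sideTouches_of_bondTouches)
open B8Eq138LandauZd (logCfg covLap)
open B8Eq138LandauZdRec (IsLandau138WZ)
open B8Eq119TwistedAxialRec (Restr129Z UnderZ underZ_iff_flmZ_eq)
open B7SectEFLinearisationRec (logCovIterZ)
open B8Eq184Proof (cfgExp)
open B8ScaledSupNorm (msup bondNorm)
open B8Eq146AExpansion (plaqCovDeriv iEta)
open B8Eq143PlaqExpansion (pdiv)
open B7AvgGaugeCovariance (uLev)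
open B7SectCDGaugeAveragesRec (uavgZ)
open B8Eq17ClassAkV1 (plaqsOf)
open MatrixLog (mlog)
open Literature.MathematicalPhysics.QuantumFieldTheory.BalabanImbrieJaffe1984to88.BIJ85AxialPropagator411 (BondSpace)
open T4Continuum (T4Family)
open ExpMeanLog (expMeanLogSU deltaSU)
open B12GaugeOrbits021 (IsResidual iter_gaugeAct_of_isResidual)
open B15Eq177GaugeInvariance (blockLift)
open T4AxialGaugeRooted (axialGaugeAt)
open Summit.QuantumFields.Balaban3D.Carriers (radialContourData)
open N07Thm4RecMemberOfCrown (sitesPerDir_anti)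
open N07Thm4RecordStructureSym152Phi (NrmSymPhiOfRecord)
open N07NormalisationSymOfRecord (symCd symTower_gaugeAct_blockLift)
open N07AxialTowerRepresentative (exists_residual_axialTower)
open N07RecordCubeVfixTorusGauge (exists_radialGauge_vfix_at_recordCube_residual)
open N07SymTauScheduleNumerics (schedule_of_fineLetter)
open N07JunctionBlockConstantDatum (exists_junction_blockConstant_datum)
open N07SymPhiTorusRowAtRecordCubeCell (torusRow_at_recordCube_cell)
open N07NrmSymPhiOfCoverRow (nrmSymPhiOfRecord_glued_of_coverRow towers_dichotomy_image_cube_zero)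
open N07DatumCrownSideConditions (lift_mem_unitaryUnits)
open B8CrownU0PointwiseOscOfFacesRec (pointwise_osc_of_faces_precomposed mem_sq_of_underZ_lamS)
open B8CfgExpBondLetterRec (norm_sub_one_le_of_logRow)

variable (F : T4Family) (N : ℕ) [NeZero N]

open N07JunctionHJPrelims (mem_domainsOfSeq_Om_of_collar exists_ne_dir guardN_of_one)

/-! ## The junction's `hJ` (133′ text) under the displayed numerics -/

set_option maxHeartbeats 1600000 in
/-- ★★★ **THE JUNCTION's `hJ`, DISCHARGED MODULO THE DISPLAYED NUMERICS `hnum`** — see the module docstring.  The witnesses: `ω := 18·ω_τ` (`ω_τ = 3840·d(d+2)(d−1)²·L^{2j+2}·ε_{j−1}η_{j−1}²`,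
INTENT-27's schedule), `X(j′,y) := R̄₀^{j′}τ(y)` for the lift `τ` of `g₁·g₂⁻¹` (the residual `symCd`-carrier over dag-n07-e's residual radial carrier ✓138 — both with the rooted top gauge of
`M^j U`), `h` := INTENT-34's block-constant lift; row 9′ per cell = ✓p760822 with `hptu` := INTENT-33 (`ω_u = 3ds(9d²+4ds)·L³ε_{j−1} + 2ds·r`), glued by ✓p748467.
[cite: Balaban1985Variational, (144) p.300, (147)–(154) pp.301–302; Balaban1985RegularSpaces, Thm. 4 p.88, Prop. 6 (1.130)–(1.138) p.99, (1.29) p.81; Balaban1985Averaging, (78)–(81) p.30, (166)–(167) p.44; Balaban1988Convergent, (2.1)–(2.2) p.254, (2.5) p.255; Balaban1987RG1, (0.1) p.251, (0.3)–(0.4) pp.252–253, (0.11) p.253, (0.21) p.256] -/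
theorem hJ_holds {Mc ρ : ℕ} (hρ : F.L ≤ ρ) {s : ℕ} {Cr Cω ω₁ κ a₀ : ℝ} {Ψ : (ℕ → ℝ) → ℕ → ℝ} (hCr : 0 ≤ Cr) (hCω : 0 ≤ Cω)
    (hnum : ∀ (K k j : ℕ) (ε : ℕ → ℝ), 1 ≤ j → j ≤ k → (∀ n, n ≤ k → 0 < ε n ∧ ε n ≤ a₀) → (∀ n, n < k → ε n ≤ 2 * ε (n + 1)) →
        48000 * (((F.P K).d : ℝ) * (((F.P K).d : ℝ) + 2) * (((F.P K).d - 1 : ℕ) : ℝ) ^ 2 * ((F.P K).L : ℝ) ^ (2 * j + 2) * (ε (j - 1) * (F.P K).eta (j - 1) ^ 2)) ≤ 1 ∧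
        480 * (((F.P K).d : ℝ) * (((F.P K).d : ℝ) + 2) * (((F.P K).d - 1 : ℕ) : ℝ) ^ 2 * ((F.P K).L : ℝ) ^ (2 * j + 2) * (ε (j - 1) * (F.P K).eta (j - 1) ^ 2)) < (FederbushMean.federbushSU (n := Fin N)).δ ∧
        6400 * ((((F.P K).d : ℝ) + 2) ^ 2 * (((F.P K).d - 1 : ℕ) : ℝ) * ((F.P K).L : ℝ) ^ (2 * j + 2) * (ε (j - 1) * (F.P K).eta (j - 1) ^ 2)) ≤ 1 ∧
        30 * ((((F.P K).d : ℝ) + 2) ^ 2 * (((F.P K).d - 1 : ℕ) : ℝ) * ((F.P K).L : ℝ) ^ (2 * j + 2) * (ε (j - 1) * (F.P K).eta (j - 1) ^ 2)) < deltaSU (Fin N) ∧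
        (∀ i, i < j → 6400 * ((((F.P K).d + 2) * (F.P K).L : ℕ) : ℝ) ^ 2 * ((F.P K).L : ℝ) ^ (i + 1) * (((((F.P K).d - 1 : ℕ) : ℝ)) * (((2 * (F.P K).L ^ (i + 1) - 1 : ℕ) : ℝ)) * (ε (j - 1) * (F.P K).eta (j - 1) ^ 2)) ≤ 1) ∧
        (∀ i, i < j → 30 * ((((F.P K).d + 2) * (F.P K).L : ℕ) : ℝ) ^ 2 * ((F.P K).L : ℝ) ^ (i + 1) * (((((F.P K).d - 1 : ℕ) : ℝ)) * (((2 * (F.P K).L ^ (i + 1) - 1 : ℕ) : ℝ)) * (ε (j - 1) * (F.P K).eta (j - 1) ^ 2)) < deltaSU (Fin N)) ∧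
        (∀ i, i < j → (((((F.P K).d + 2) * (F.P K).L : ℕ) : ℝ) ^ 2 / 4) * ((4 * (((((F.P K).d - 1 : ℕ) : ℝ)) * ((2 * (F.P K).L - 1 : ℕ) : ℝ)) + 1) * (240 * ((((F.P K).d + 2) * (F.P K).L : ℕ) : ℝ) * ((F.P K).L : ℝ) ^ i * (((((F.P K).d - 1 : ℕ) : ℝ)) * (((2 * (F.P K).L ^ (i + 1) - 1 : ℕ) : ℝ)) * (ε (j - 1) * (F.P K).eta (j - 1) ^ 2)))) < deltaSU (Fin N)) ∧
        C0Z (F.P K).d * ((((F.P K).L : ℝ) ^ 3 * ε (j - 1)) * ((F.P K).L : ℝ) ^ 2) ≤ 1 / 3 ∧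
        2 * ((((F.P K).L : ℝ) ^ 3 * ε (j - 1)) * ((F.P K).L : ℝ) ^ 2) ≤ c2' (F.P K).d (F.P K).L ∧
        11 * ((F.P K).d : ℝ) ^ 2 * ((F.P K).L : ℝ) ^ 2 * (((F.P K).L : ℝ) ^ 3 * ε (j - 1)) ≤ 1 / 6 ∧
        (3840 * (((F.P K).d : ℝ) * (((F.P K).d : ℝ) + 2) * (((F.P K).d - 1 : ℕ) : ℝ) ^ 2 * ((F.P K).L : ℝ) ^ (2 * j + 2) * (ε (j - 1) * (F.P K).eta (j - 1) ^ 2))) ≤ 1 / 128 ∧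
        4 * (3840 * (((F.P K).d : ℝ) * (((F.P K).d : ℝ) + 2) * (((F.P K).d - 1 : ℕ) : ℝ) ^ 2 * ((F.P K).L : ℝ) ^ (2 * j + 2) * (ε (j - 1) * (F.P K).eta (j - 1) ^ 2))) < deltaSU (Fin N) ∧
        (3840 * (((F.P K).d : ℝ) * (((F.P K).d : ℝ) + 2) * (((F.P K).d - 1 : ℕ) : ℝ) ^ 2 * ((F.P K).L : ℝ) ^ (2 * j + 2) * (ε (j - 1) * (F.P K).eta (j - 1) ^ 2))) + (3 * ((F.P K).d : ℝ) * ((((F.P K).L - 1) / 2 : ℕ) : ℝ) * ((9 * ((F.P K).d : ℝ) ^ 2 + 4 * ((F.P K).d : ℝ) * ((((F.P K).L - 1) / 2 : ℕ) : ℝ)) * (((F.P K).L : ℝ) ^ 3 * ε (j - 1))) + 2 * ((F.P K).d : ℝ) * ((((F.P K).L - 1) / 2 : ℕ) : ℝ) * (Cr * (((F.P K).L : ℝ) ^ 3 * ε (j - 1)) + Cω * (18 * (3840 * (((F.P K).d : ℝ) * (((F.P K).d : ℝ) + 2) * (((F.P K).d - 1 : ℕ) : ℝ) ^ 2 * ((F.P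 K).L : ℝ) ^ (2 * j + 2) * (ε (j - 1) * (F.P K).eta (j - 1) ^ 2)))))) ≤ 1 / 512 ∧
        4096 * ((F.P K).L : ℝ)⁻¹ * ((3840 * (((F.P K).d : ℝ) * (((F.P K).d : ℝ) + 2) * (((F.P K).d - 1 : ℕ) : ℝ) ^ 2 * ((F.P K).L : ℝ) ^ (2 * j + 2) * (ε (j - 1) * (F.P K).eta (j - 1) ^ 2))) + (3 * ((F.P K).d : ℝ) * ((((F.P K).L - 1) / 2 : ℕ) : ℝ) * ((9 * ((F.P K).d : ℝ) ^ 2 + 4 * ((F.P K).d : ℝ) * ((((F.P K).L - 1) / 2 : ℕ) : ℝ)) * (((F.P K).L : ℝ) ^ 3 * ε (j - 1))) + 2 * ((F.P K).d : ℝ) * ((((F.P K).L - 1) / 2 : ℕ) : ℝ) * (Cr * (((F.P K).L : ℝ) ^ 3 * ε (j - 1)) + Cω * (18 * (3840 * (((F.P K).d : ℝ) * (((F.P K).d : ℝ) + 2) * (((F.P K).d - 1 : ℕ) : ℝ) ^ 2 * ((F.P K).L : ℝ) ^ (2 * j + 2) * (ε (j - 1) * (F.P K).eta (j - 1) ^ 2)))))))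 ≤ 1 ∧
        4 * ((3840 * (((F.P K).d : ℝ) * (((F.P K).d : ℝ) + 2) * (((F.P K).d - 1 : ℕ) : ℝ) ^ 2 * ((F.P K).L : ℝ) ^ (2 * j + 2) * (ε (j - 1) * (F.P K).eta (j - 1) ^ 2))) + (3 * ((F.P K).d : ℝ) * ((((F.P K).L - 1) / 2 : ℕ) : ℝ) * ((9 * ((F.P K).d : ℝ) ^ 2 + 4 * ((F.P K).d : ℝ) * ((((F.P K).L - 1) / 2 : ℕ) : ℝ)) * (((F.P K).L : ℝ) ^ 3 * ε (j - 1))) + 2 * ((F.P K).d : ℝ) * ((((F.P K).L - 1) / 2 : ℕ) : ℝ) * (Cr * (((F.P K).L : ℝ) ^ 3 * ε (j - 1)) + Cω * (18 * (3840 * (((F.P K).d : ℝ) * (((F.P K).d : ℝ) + 2) * (((F.P K).d - 1 : ℕ) : ℝ) ^ 2 * ((F.P K).L : ℝ) ^ (2 * j + 2) * (ε (j - 1) * (F.P K).eta (j - 1) ^ 2))))))) + 32768 * ((3840 * (((F.P K).d : ℝ) * (((F.P K).d : ℝ) + 2) * (((F.P K).d - 1 : ℕ) : ℝ) ^ 2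 * ((F.P K).L : ℝ) ^ (2 * j + 2) * (ε (j - 1) * (F.P K).eta (j - 1) ^ 2))) + (3 * ((F.P K).d : ℝ) * ((((F.P K).L - 1) / 2 : ℕ) : ℝ) * ((9 * ((F.P K).d : ℝ) ^ 2 + 4 * ((F.P K).d : ℝ) * ((((F.P K).L - 1) / 2 : ℕ) : ℝ)) * (((F.P K).L : ℝ) ^ 3 * ε (j - 1))) + 2 * ((F.P K).d : ℝ) * ((((F.P K).L - 1) / 2 : ℕ) : ℝ) * (Cr * (((F.P K).L : ℝ) ^ 3 * ε (j - 1)) + Cω * (18 * (3840 * (((F.P K).d : ℝ) * (((F.P K).d : ℝ) + 2) * (((F.P K).d - 1 : ℕ) : ℝ) ^ 2 * ((F.P K).L : ℝ) ^ (2 * j + 2) * (ε (j - 1) * (F.P K).eta (j - 1) ^ 2))))))) ^ 2 < deltaSU (Fin N) ∧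
        18 * (3840 * (((F.P K).d : ℝ) * (((F.P K).d : ℝ) + 2) * (((F.P K).d - 1 : ℕ) : ℝ) ^ 2 * ((F.P K).L : ℝ) ^ (2 * j + 2) * (ε (j - 1) * (F.P K).eta (j - 1) ^ 2))) ≤ ω₁ ∧
        2 * ((Cr * (((F.P K).L : ℝ) ^ 3 * ε (j - 1)) + Cω * (18 * (3840 * (((F.P K).d : ℝ) * (((F.P K).d : ℝ) + 2) * (((F.P K).d - 1 : ℕ) : ℝ) ^ 2 * ((F.P K).L : ℝ) ^ (2 * j + 2) * (ε (j - 1) * (F.P K).eta (j - 1) ^ 2))))) * ((F.P K).L : ℝ) ^ 4) < κ * ε j ∧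
        4 * ((N : ℝ) * (Cr * (((F.P K).L : ℝ) ^ 3 * ε (j - 1)) + Cω * (18 * (3840 * (((F.P K).d : ℝ) * (((F.P K).d : ℝ) + 2) * (((F.P K).d - 1 : ℕ) : ℝ) ^ 2 * ((F.P K).L : ℝ) ^ (2 * j + 2) * (ε (j - 1) * (F.P K).eta (j - 1) ^ 2)))))) < 2 * Real.pi ∧
        1024 * (4 * ((3840 * (((F.P K).d : ℝ) * (((F.P K).d : ℝ) + 2) * (((F.P K).d - 1 : ℕ) : ℝ) ^ 2 * ((F.P K).L : ℝ) ^ (2 * j + 2) * (ε (j - 1) * (F.P K).eta (j - 1) ^ 2))) + (3 * ((F.P K).d : ℝ) * ((((F.P K).L - 1) / 2 : ℕ) : ℝ) * ((9 * ((F.P K).d : ℝ) ^ 2 + 4 * ((F.P K).d : ℝ) * ((((F.P K).L - 1) / 2 : ℕ) : ℝ)) * (((F.P K).L : ℝ) ^ 3 * ε (j - 1))) + 2 * ((F.P K).d : ℝ) * ((((F.P K).L - 1) / 2 : ℕ) : ℝ) * (Cr * (((F.P K).L : ℝ) ^ 3 * ε (j - 1)) + Cω * (18 * (3840 * (((F.P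 K).d : ℝ) * (((F.P K).d : ℝ) + 2) * (((F.P K).d - 1 : ℕ) : ℝ) ^ 2 * ((F.P K).L : ℝ) ^ (2 * j + 2) * (ε (j - 1) * (F.P K).eta (j - 1) ^ 2)))))))) ^ 2 ≤ Ψ ε j) :
    ∀ (ν : Stage7Numerics) (M : ℕ) (g : ℕ → ℝ) (K k : ℕ) (sq : SeqOfRecord F ν M g K k), Sect2.SeqSeparated ν.M₁ sq → 0 < ν.M₁ →
      (11 * 4 + 4 * ρ + Mc + 3) * F.L ≤ ν.M₁ → Mc + 11 * 4 + 6 * ρ ≤ (F.P K).sitesPerDir k → 1 ≤ k →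
      (∀ i : ℕ, 1 ≤ i → i ≤ k →
        F.L ^ (s + 1) ∣ M * RkOfRecord (F.P K).L ν.r (g i) ∧ dCubeSide (F.P K).L M (RkOfRecord (F.P K).L ν.r (g i)) i ∣ (F.P K).sitesPerDir 0) →
      ∀ (ε : ℕ → ℝ), (∀ n, n ≤ k → 0 < ε n ∧ ε n ≤ a₀) → (∀ n, n < k → ε n ≤ 2 * ε (n + 1)) →
      ∀ U : GaugeField (F.P K) 0 (SU N),
      (∀ n, n ≤ k → PlaqSmallOn (Sect2.omegaPlaqsTop sq.Ω (suppDomOfRecord F ν K sq.Ω) n) (ε n * (F.P K).eta n ^ 2) U) →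
      (∀ n, n ≤ k → Sect2.CoDivSmallOn (Sect2.omegaBondsTop sq.Ω (suppDomOfRecord F ν K sq.Ω) n) (ε n * (F.P K).eta n ^ 3) U) →
      ∀ (j : ℕ) (hk : j ≤ (F.P K).m + (F.P K).K) (hj1 : 1 ≤ j), j ≤ k → ∀ (idx : Pt (F.P K).d),
      (∃ x ∈ box (F.P K).L (cornerP (F.P K) Mc ρ idx) (sideP (F.P K) Mc ρ) j, ∃ y : Pt (F.P K).d, cover (F.P K) y ∈ sq.Ω j ∧ Within ((3 : ℕ) : ℤ) x y) →
      letI : CStarAlgebra (MatA N) := {};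
      -- GIVEN the collar `π(□̃) ⊆ Ω_{j−1}` of the datum …
      cover (F.P K) '' tcube (F.P K).L (cornerP (F.P K) Mc ρ idx) (sideP (F.P K) Mc ρ) ρ j ⊆
          (if j - 1 = 0 then suppDomOfRecord F ν K sq.Ω else sq.Ω (j - 1)) →
      -- … the non-wrapping of `□̃` and the axial smallness `𝔄_j` at `α := L³·ε_{j−1}` (constant family `□̃ᶻ` AND the dented family) …
      Set.InjOn (cover (F.P K)) (tcube (F.P K).L (cornerP (F.P K) Mc ρ idx) (sideP (F.P K) Mc ρ) ρ j) →
      InAk (F.P K).L j ((F.P K).eta j) (((F.P K).L : ℝ) ^ 3 * ε (j - 1))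
          (fun _ => tcubeZ (F.P K).L (cornerP (F.P K) Mc ρ idx) (sideP (F.P K) Mc ρ) ρ j) (fun x μ => ιSU N (U ⟨cover (F.P K) (x + fun _ => (ctrShift (F.P K).L j : ℤ)), μ⟩)) →
      InAk (F.P K).L j ((F.P K).eta j) (((F.P K).L : ℝ) ^ 3 * ε (j - 1)) (dentFamZ (F.P K) j Mc ρ idx ((domainsOfSeq sq.Ω j hk).Om j)) (fun x μ => ιSU N (U ⟨cover (F.P K) (x + fun _ => (ctrShift (F.P K).L j : ℤ)), μ⟩)) →
      -- … the junction CHOOSES `h`, `X`, `ω` with the crown's input rows and the numerics at `r := Cr·(L³ε_{j−1}) + Cω·ω` …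
      ∃ (h : B7Prop1Explicit.Site (F.P K).d → (MatA N)ˣ) (X : ℕ → B7Prop1Explicit.Site (F.P K).d → (MatA N)ˣ) (ω : ℝ),
        (∀ x, h x ∈ specialUnitaryUnits (Fin N)) ∧ (∀ x, x ∉ (recordCubePZ (F.P K) j hj1 hk Mc ρ hρ idx ((domainsOfSeq sq.Ω j hk).Om j)).sq 0 → h x = 1) ∧
        (∀ j', 1 ≤ j' → j' ≤ j → ∀ y ∈ (recordCubePZ (F.P K) j hj1 hk Mc ρ hρ idx ((domainsOfSeq sq.Ω j hk).Om j)).lamS j', ∀ x, UnderZ (F.P K).L j' y x → h x = X j' y) ∧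
        0 ≤ ω ∧ ω ≤ ω₁ ∧
        (∀ j', j' ≤ j → ∀ (z : B7Prop1Explicit.Site (F.P K).d) (μ : Fin (F.P K).d),
          (∀ x, InBox (fun i => ((F.P K).L : ℤ) ^ j' * z i - (ctrShift (F.P K).L j' : ℤ))
              (fun i => ((F.P K).L : ℤ) ^ j' * z i + (ctrShift (F.P K).L j' : ℤ) + if i = μ then ((F.P K).L : ℤ) ^ j' else 0) x →
            x ∈ (recordCubePZ (F.P K) j hj1 hk Mc ρ hρ idx ((domainsOfSeq sq.Ω j hk).Om j)).sq (j' - 1)) →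
          ‖((uLev (F.P K).L h j' z : (MatA N)ˣ) : MatA N) - ((uLev (F.P K).L h j' (z + e μ) : (MatA N)ˣ) : MatA N)‖ ≤ ω) ∧
        (∀ b ∈ {b : B7Prop1Explicit.Site (F.P K).d × Fin (F.P K).d | SideTouches ((recordCubePZ (F.P K) j hj1 hk Mc ρ hρ idx ((domainsOfSeq sq.Ω j hk).Om j)).sq 0) b.1 b.2},
          ‖((h b.1 : (MatA N)ˣ) : MatA N) - ((h (b.1 + e b.2) : (MatA N)ˣ) : MatA N)‖ ≤ ω) ∧
        (∀ t : ℝ, 0 ≤ t → t ≤ ((F.P K).L : ℝ) ^ 4 → 2 * ((Cr * (((F.P K).L : ℝ) ^ 3 * ε (j - 1)) + Cω * ω) * t) < κ * ε j) ∧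
        4 * ((N : ℝ) * (Cr * (((F.P K).L : ℝ) ^ 3 * ε (j - 1)) + Cω * ω)) < 2 * Real.pi ∧
        -- … and, for the crown's output `u₀` with ALL its rows (VERBATIM `DatumCrownPhiAt`) and the door's `(u, A)` with the door formula and rows 1–8 + (T2b), SUPPLIES row 9′
        ∀ u₀ : B7Prop1Explicit.Site (F.P K).d → (MatA N)ˣ,
            (∀ x, u₀ x ∈ specialUnitaryUnits (Fin N)) ∧
              (∀ x, x ∉ (recordCubePZ (F.P K) j hj1 hk Mc ρ hρ idx ((domainsOfSeq sq.Ω j hk).Om j)).sq 0 → u₀ x = 1) ∧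
              Restr129Z (F.P K).L j (recordCubePZ (F.P K) j hj1 hk Mc ρ hρ idx ((domainsOfSeq sq.Ω j hk).Om j)).lamS (1 : B7Prop1Explicit.Site (F.P K).d → Fin (F.P K).d → (MatA N)ˣ) u₀ ∧
              IsLandau138WZ (F.P K).L j ((F.P K).eta j) ((recordCubePZ (F.P K) j hj1 hk Mc ρ hρ idx ((domainsOfSeq sq.Ω j hk).Om j)).sq 0) (recordCubePZ (F.P K) j hj1 hk Mc ρ hρ idx ((domainsOfSeq sq.Ω j hk).Om j)).lamS
                (1 : B7Prop1Explicit.Site (F.P K).d → Fin (F.P K).d → (MatA N)ˣ)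
                ((recordCubePZ (F.P K) j hj1 hk Mc ρ hρ idx ((domainsOfSeq sq.Ω j hk).Om j)).fixed (fun x μ => ιSU N (U ⟨cover (F.P K) (x + fun _ => (ctrShift (F.P K).L j : ℤ)), μ⟩)) (h⁻¹ * u₀)) ∧
              (∀ j', j' ≤ j → ∀ b ∈ {b : B7Prop1Explicit.Site (F.P K).d × Fin (F.P K).d | SideTouches ((recordCubePZ (F.P K) j hj1 hk Mc ρ hρ idx ((domainsOfSeq sq.Ω j hk).Om j)).sq j') b.1 b.2},
                (recordCubePZ (F.P K) j hj1 hk Mc ρ hρ idx ((domainsOfSeq sq.Ω j hk).Om j)).fixed (fun x μ => ιSU N (U ⟨cover (F.P K) (x + fun _ => (ctrShift (F.P K).L j : ℤ)), μ⟩)) (h⁻¹ * u₀) b.1 b.2 =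
                    cfgExp ((F.P K).eta j) (logCfg ((F.P K).eta j) ((recordCubePZ (F.P K) j hj1 hk Mc ρ hρ idx ((domainsOfSeq sq.Ω j hk).Om j)).fixed
                      (fun x μ => ιSU N (U ⟨cover (F.P K) (x + fun _ => (ctrShift (F.P K).L j : ℤ)), μ⟩)) (h⁻¹ * u₀))) b.1 b.2 ∧
                  IsSelfAdjoint (logCfg ((F.P K).eta j) ((recordCubePZ (F.P K) j hj1 hk Mc ρ hρ idx ((domainsOfSeq sq.Ω j hk).Om j)).fixed
                      (fun x μ => ιSU N (U ⟨cover (F.P K) (x + fun _ => (ctrShift (F.P K).L j : ℤ)), μ⟩)) (h⁻¹ * u₀)) b.1 b.2) ∧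
                  ‖logCfg ((F.P K).eta j) ((recordCubePZ (F.P K) j hj1 hk Mc ρ hρ idx ((domainsOfSeq sq.Ω j hk).Om j)).fixed
                      (fun x μ => ιSU N (U ⟨cover (F.P K) (x + fun _ => (ctrShift (F.P K).L j : ℤ)), μ⟩)) (h⁻¹ * u₀)) b.1 b.2‖ ≤
                    (Cr * (((F.P K).L : ℝ) ^ 3 * ε (j - 1)) + Cω * ω) * (((F.P K).L : ℝ) ^ j' * (F.P K).eta j)⁻¹) ∧
              (∀ x, (((recordCubePZ (F.P K) j hj1 hk Mc ρ hρ idx ((domainsOfSeq sq.Ω j hk).Om j)).vfix (fun x μ => ιSU N (U ⟨cover (F.P K) (x + fun _ => (ctrShift (F.P K).L j : ℤ)), μ⟩)))⁻¹ * (h⁻¹ * u₀)) x ∈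
                specialUnitaryUnits (Fin N)) ∧
              AgreeOn (B8Ineq130Rec.tlo (F.P K).L (tLo (cornerP (F.P K) Mc ρ idx) ρ) j) (B8Ineq130Rec.thi (F.P K).L (tHi (cornerP (F.P K) Mc ρ idx) (sideP (F.P K) Mc ρ) ρ) j)
                (gaugeAct (((recordCubePZ (F.P K) j hj1 hk Mc ρ hρ idx ((domainsOfSeq sq.Ω j hk).Om j)).vfix (fun x μ => ιSU N (U ⟨cover (F.P K) (x + fun _ => (ctrShift (F.P K).L j : ℤ)), μ⟩)))⁻¹ * (h⁻¹ * u₀))⁻¹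
                  (fun x μ => ιSU N (U ⟨cover (F.P K) (x + fun _ => (ctrShift (F.P K).L j : ℤ)), μ⟩)))
                ((recordCubePZ (F.P K) j hj1 hk Mc ρ hρ idx ((domainsOfSeq sq.Ω j hk).Om j)).fixed (fun x μ => ιSU N (U ⟨cover (F.P K) (x + fun _ => (ctrShift (F.P K).L j : ℤ)), μ⟩)) (h⁻¹ * u₀)) ∧
              msup (F.P K).L j ((F.P K).eta j) (-(2 : ℝ))
                  (fun j' (q : Fin (F.P K).d × Fin (F.P K).d × B7Prop1Explicit.Site (F.P K).d) => SideTouches ((recordCubePZ (F.P K) j hj1 hk Mc ρ hρ idx ((domainsOfSeq sq.Ω j hk).Om j)).sq j') q.2.2 q.2.1)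
                  (fun q => covDerivFwd ((F.P K).eta j) (1 : B7Prop1Explicit.Site (F.P K).d → Fin (F.P K).d → (MatA N)ˣ) q.1
                    (fun z => (recordCubePZ (F.P K) j hj1 hk Mc ρ hρ idx ((domainsOfSeq sq.Ω j hk).Om j)).expo ((F.P K).eta j)
                      (fun x μ => ιSU N (U ⟨cover (F.P K) (x + fun _ => (ctrShift (F.P K).L j : ℤ)), μ⟩)) (h⁻¹ * u₀) z q.2.1) q.2.2) ≤ Cr * (((F.P K).L : ℝ) ^ 3 * ε (j - 1)) + Cω * ω ∧
              bondNorm (F.P K).L j ((F.P K).eta j) (-(3 : ℝ)) (recordCubePZ (F.P K) j hj1 hk Mc ρ hρ idx ((domainsOfSeq sq.Ω j hk).Om j)).sq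
                  (fun x μ => pdiv ((F.P K).eta j) (1 : B7Prop1Explicit.Site (F.P K).d → Fin (F.P K).d → (MatA N)ˣ)
                    (plaqCovDeriv ((F.P K).eta j) (1 : B7Prop1Explicit.Site (F.P K).d → Fin (F.P K).d → (MatA N)ˣ)
                      ((recordCubePZ (F.P K) j hj1 hk Mc ρ hρ idx ((domainsOfSeq sq.Ω j hk).Om j)).expo ((F.P K).eta j)
                        (fun x μ => ιSU N (U ⟨cover (F.P K) (x + fun _ => (ctrShift (F.P K).L j : ℤ)), μ⟩)) (h⁻¹ * u₀))) μ x) ≤ Cr * (((F.P K).L : ℝ) ^ 3 * ε (j - 1)) + Cω * ω ∧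
              bondNorm (F.P K).L j ((F.P K).eta j) (-(3 : ℝ)) (recordCubePZ (F.P K) j hj1 hk Mc ρ hρ idx ((domainsOfSeq sq.Ω j hk).Om j)).sq
                  (fun x μ => covLap ((F.P K).eta j) (1 : B7Prop1Explicit.Site (F.P K).d → Fin (F.P K).d → (MatA N)ˣ)
                    (fun z => (recordCubePZ (F.P K) j hj1 hk Mc ρ hρ idx ((domainsOfSeq sq.Ω j hk).Om j)).expo ((F.P K).eta j)
                      (fun x μ => ιSU N (U ⟨cover (F.P K) (x + fun _ => (ctrShift (F.P K).L j : ℤ)), μ⟩)) (h⁻¹ * u₀) z μ) x) ≤ Cr * (((F.P K).L : ℝ) ^ 3 * ε (j - 1)) + Cω * ω ∧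
              (∀ (x : B7Prop1Explicit.Site (F.P K).d) (μ : Fin (F.P K).d),
                bLoZ (F.P K).L (cornerP (F.P K) Mc ρ idx) 0 0 ≤ x → x + e μ ≤ bHiZ (F.P K).L (cornerP (F.P K) Mc ρ idx) (sideP (F.P K) Mc ρ) 0 0 →
                (recordCubePZ (F.P K) j hj1 hk Mc ρ hρ idx ((domainsOfSeq sq.Ω j hk).Om j)).inTop x → (recordCubePZ (F.P K) j hj1 hk Mc ρ hρ idx ((domainsOfSeq sq.Ω j hk).Om j)).inTop (x + e μ) →
                logCovIterZ (F.P K).L (1 : B7Prop1Explicit.Site (F.P K).d → Fin (F.P K).d → (MatA N)ˣ)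
                    (iEta ((F.P K).eta j) ((recordCubePZ (F.P K) j hj1 hk Mc ρ hρ idx ((domainsOfSeq sq.Ω j hk).Om j)).expo ((F.P K).eta j)
                      (fun x μ => ιSU N (U ⟨cover (F.P K) (x + fun _ => (ctrShift (F.P K).L j : ℤ)), μ⟩)) (h⁻¹ * u₀))) j x μ =
                  mlog ((avgIterZ (F.P K).L (gaugeAct h ((recordCubePZ (F.P K) j hj1 hk Mc ρ hρ idx ((domainsOfSeq sq.Ω j hk).Om j)).axial
                    (fun x μ => ιSU N (U ⟨cover (F.P K) (x + fun _ => (ctrShift (F.P K).L j : ℤ)), μ⟩)))) j x μ : (MatA N)ˣ) : MatA N)) →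
        ∀ (u : GaugeTransf (F.P K) 0 (SU N)) (A : PBond (F.P K) 0 → MatA N),
            -- the door formula on `□₀ᶻ`
            (∀ x, x ∈ (recordCubePZ (F.P K) j hj1 hk Mc ρ hρ idx ((domainsOfSeq sq.Ω j hk).Om j)).sq 0 → ιSU N (u (cover (F.P K) (x + fun _ => (ctrShift (F.P K).L j : ℤ)))) = ((h⁻¹ * u₀) x)⁻¹ * (recordCubePZ (F.P K) j hj1 hk Mc ρ hρ idx ((domainsOfSeq sq.Ω j hk).Om j)).vfix (fun x μ => ιSU N (U ⟨cover (F.P K) (x + fun _ => (ctrShift (F.P K).L j : ℤ)), μ⟩)) x) ∧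
            -- rows 1–8 + (T2b) of `HThm4RecSym152PhiEG` for `(u, A)`
            (∀ b ∈ (Sect2.regionOfSet (F.P K) (cover (F.P K) '' box (F.P K).L (cornerP (F.P K) Mc ρ idx) (sideP (F.P K) Mc ρ) j)).bonds,
              gaugeU (fun x => ιSU N (u x)) (fun b' => ιSU N (U b')) b = expI ((F.P K).eta j) (A b)) ∧
            (∀ b ∈ (Sect2.regionOfSet (F.P K) (cover (F.P K) '' cube (F.P K).L (cornerP (F.P K) Mc ρ idx) (sideP (F.P K) Mc ρ) ρ j 0)).bonds,
              gaugeU (fun x => ιSU N (u x)) (fun b' => ιSU N (U b')) b = expI ((F.P K).eta j) (A b)) ∧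
            (∀ j', j' ≤ j →
              ∀ b ∈ (Sect2.regionOfSet (F.P K) (cover (F.P K) '' cube (F.P K).L (cornerP (F.P K) Mc ρ idx) (sideP (F.P K) Mc ρ) ρ j j')).bonds,
                ‖A b‖ < κ * ε j * ((F.P K).L : ℝ) ^ (j - j')) ∧
            (∀ j', j' ≤ j →
              ∀ q ∈ (Sect2.regionOfSet (F.P K) (cover (F.P K) '' cube (F.P K).L (cornerP (F.P K) Mc ρ idx) (sideP (F.P K) Mc ρ) ρ j j')).dpairs,
                ‖grad ((F.P K).eta j) q.2.1 (fun y => A ⟨y, q.2.2⟩) q.1‖ < κ * ε j * ((F.P K).L : ℝ) ^ (2 * (j - j'))) ∧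
            (∀ b ∈ (Sect2.regionOfSet (F.P K) (cover (F.P K) '' box (F.P K).L (cornerP (F.P K) Mc ρ idx) (sideP (F.P K) Mc ρ) j)).bonds,
              ‖A b‖ < κ * ε j) ∧
            (∀ q ∈ (Sect2.regionOfSet (F.P K) (cover (F.P K) '' box (F.P K).L (cornerP (F.P K) Mc ρ idx) (sideP (F.P K) Mc ρ) j)).dpairs,
              ‖grad ((F.P K).eta j) q.2.1 (fun y => A ⟨y, q.2.2⟩) q.1‖ < κ * ε j) ∧
            (∀ b ∈ Sect2.bondsDeep (cover (F.P K) '' box (F.P K).L (cornerP (F.P K) Mc ρ idx) (sideP (F.P K) Mc ρ) j),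
              ‖Sect2.codiffCurlA ((F.P K).eta j) A b.src b.dir‖ < κ * ε j) ∧
            (∀ b ∈ Sect2.bondsDeep (cover (F.P K) '' box (F.P K).L (cornerP (F.P K) Mc ρ idx) (sideP (F.P K) Mc ρ) j),
              ‖∑ ν' : Fin (F.P K).d, (((F.P K).eta j : ℝ) : ℂ)⁻¹ •
                  (grad ((F.P K).eta j) ν' (fun y => A ⟨y, b.dir⟩) (b.src.unshift ν') - grad ((F.P K).eta j) ν' (fun y => A ⟨y, b.dir⟩) b.src)‖ < κ * ε j) ∧
            (∀ φ : MatA N →L[ℂ] ℂ,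
              RE (domainsMeet (cubeDomains (F.P K) (cornerP (F.P K) Mc ρ idx) (sideP (F.P K) Mc ρ) ρ j hk) (domainsOfSeq sq.Ω j hk)) ((F.P K).eta j)⁻¹
                  (dsE ((F.P K).eta j)⁻¹ (WithLp.toLp 2 fun b => (φ (A b)).re : BondSpace (F.P K))) = 0 ∧
              RE (domainsMeet (cubeDomains (F.P K) (cornerP (F.P K) Mc ρ idx) (sideP (F.P K) Mc ρ) ρ j hk) (domainsOfSeq sq.Ω j hk)) ((F.P K).eta j)⁻¹
                  (dsE ((F.P K).eta j)⁻¹ (WithLp.toLp 2 fun b => (φ (A b)).im : BondSpace (F.P K))) = 0) →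
        ∃ u' : GaugeTransf (F.P K) 0 (SU N), (∀ x ∈ cover (F.P K) '' cube (F.P K).L (cornerP (F.P K) Mc ρ idx) (sideP (F.P K) Mc ρ) ρ j 0, u' x = u x) ∧
          NrmSymPhiOfRecord F N Mc ρ (Ψ ε j) ν M g K k sq U j idx u' A := by
  intro ν M g K k sq hsep hM₁ hfl hnw hk1 hgrid ε hε hcomp U hP hD j hk hj1 hjk idx hmeet hcollar hinj hInAk0 hInAk
  letI : CStarAlgebra (MatA N) := {}
  obtain ⟨n1, n2, n3, n4, n5, n6, n7, n8, n9, n10, n11, n12, n13, n14, n15, n16, n17, n18, n19⟩ := hnum K k j ε hj1 hjk hε hcomp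
  -- ### constants of the record
  obtain ⟨s₀, hLs⟩ : ∃ s₀, (F.P K).L = 2 * s₀ + 1 := (F.P K).hL.1
  have hLo : Odd (F.P K).L := ⟨s₀, hLs⟩
  have hL13 : 13 ≤ (F.P K).L := by have h11 := F.hL11; rw [T4Family.P_L] at hLs ⊢; omega
  have hs1 : 1 ≤ s₀ := by omega
  have hss : ((F.P K).L - 1) / 2 = s₀ := by omega
  have hd4 : (F.P K).d = 4 := T4Family.P_d F K
  have hd1 : 1 ≤ (F.P K).d := by rw [hd4]; norm_num
  have hd2 : 2 ≤ (F.P K).d := by rw [hd4]; norm_num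
  have hL2 : 2 ≤ (F.P K).L := by omega
  have hρ' : (F.P K).L ≤ ρ := by rw [T4Family.P_L]; exact hρ
  have hρ1 : 1 ≤ ρ := le_trans (F.P K).L_pos hρ'
  have hLpos : (0 : ℝ) < ((F.P K).L : ℝ) := by exact_mod_cast (F.P K).L_pos
  have hL13R : (13 : ℝ) ≤ ((F.P K).L : ℝ) := by exact_mod_cast hL13
  have hθ0 : (0 : ℝ) ≤ ((F.P K).L : ℝ)⁻¹ := inv_nonneg.2 hLpos.le
  have hθ8 : ((F.P K).L : ℝ)⁻¹ ≤ 1 / 8 := by rw [inv_le_comm₀ hLpos (by norm_num)]; linarith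
  have hθ1 : ((F.P K).L : ℝ)⁻¹ ≤ 1 := hθ8.trans (by norm_num)
  have hηpos : ∀ n, 0 < (F.P K).eta n := fun n => B3GkZeroTorusRescaled.eta_pos (F.P K) n
  have hεj : 0 < ε (j - 1) := (hε (j - 1) (by omega)).1
  have hεj0 : 0 ≤ ε (j - 1) := hεj.le
  have hεjj : 0 < ε j := (hε j hjk).1
  -- ### the datum's dented cube
  set c := recordCubePZ (F.P K) j hj1 hk Mc ρ hρ idx ((domainsOfSeq sq.Ω j hk).Om j) with hc
  -- ### the guard: non-wrapping windows below `j`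
  have hg : Mc + 11 * (F.P K).d + 6 * ρ ≤ (F.P K).sitesPerDir j := by rw [hd4]; exact hnw.trans (sitesPerDir_anti (F.P K) hjk)
  have hN : ∀ n, n < j → (F.P K).L < (F.P K).sitesPerDir n := fun n hn => by have h1 := sitesPerDir_anti (F.P K) (show n ≤ j by omega); omega
  -- ### the fine letter on the collar region (row (17) at level `j − 1`) and the schedule (INTENT-27)
  have ha₀' : 0 < (ε (j - 1) * (F.P K).eta (j - 1) ^ 2) := mul_pos (hε (j - 1) (by omega)).1 (pow_pos (hηpos _) 2)
  have hU : PlaqSmallOn (plaqsOf (if j - 1 = 0 then suppDomOfRecord F ν K sq.Ω else sq.Ω (j - 1))) (ε (j - 1) * (F.P K).eta (j - 1) ^ 2) U := hP (j - 1) (by omega)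
  obtain ⟨a_, ωτ, hωτ, hωτ0, -, hbud, hgd, -, h100, hguard, hE⟩ := schedule_of_fineLetter (P := F.P K) N hd2 hL2 j ha₀' n1 n2 n3 n4
  subst hωτ
  -- the schedule itself (INTENT-27's witness, whose rows `h100`/`hguard`/`hE` are stated explicitly)
  set a : ℕ → ℝ := fun n => 240 * (((((F.P K).d + 2) * (F.P K).L : ℕ) : ℝ) * ((F.P K).L : ℝ) ^ n * (((((F.P K).d - 1 : ℕ) : ℝ)) * ((((F.P K).L ^ (n + 1) - 1 : ℕ) : ℝ)) * (ε (j - 1) * (F.P K).eta (j - 1) ^ 2))) with ha_def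
  have hEpos : ∀ n : ℕ, 0 < ((((F.P K).d + 2) * (F.P K).L : ℕ) : ℝ) * ((F.P K).L : ℝ) ^ n * (((((F.P K).d - 1 : ℕ) : ℝ)) * ((((F.P K).L ^ (n + 1) - 1 : ℕ) : ℝ)) * (ε (j - 1) * (F.P K).eta (j - 1) ^ 2)) := by
    intro n
    have h1 : (0 : ℝ) < ((((F.P K).d + 2) * (F.P K).L : ℕ) : ℝ) := by exact_mod_cast Nat.mul_pos (by omega) (F.P K).L_pos
    have h2 : (0 : ℝ) < ((((F.P K).L ^ (n + 1) - 1 : ℕ) : ℝ)) := by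
      have h3 : 1 < (F.P K).L ^ (n + 1) := Nat.one_lt_pow (by omega) (by omega)
      exact_mod_cast (show 0 < (F.P K).L ^ (n + 1) - 1 by omega)
    have h3 : (0 : ℝ) < (((F.P K).d - 1 : ℕ) : ℝ) := by exact_mod_cast (show 0 < (F.P K).d - 1 by omega)
    positivity
  have ha : ∀ n, 0 ≤ a n := fun n => by have := hEpos n; simp only [ha_def]; positivity
  have haa : ∀ n, n < j → 120 * ((((F.P K).d + 2) * (F.P K).L : ℕ) : ℝ) * ((F.P K).L : ℝ) ^ n * (((((F.P K).d - 1 : ℕ) : ℝ)) * ((((F.P K).L ^ (n + 1) - 1 : ℕ) : ℝ)) * (ε (j - 1) * (F.P K).eta (j - 1) ^ 2)) < a n := by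
    intro n _; have := hEpos n; simp only [ha_def]; nlinarith
  -- ### the carriers: residual `symCd`-tower `w_s`; dag-n07-e's residual radial tower `w_r` with `hvfix` (✓138)
  obtain ⟨ws, hres_s, hax_s⟩ := exists_residual_axialTower (avOfRecord F N K) (fun i => symCd F N K i) j hk U
  obtain ⟨wr, hres_r, -, hax₂, hvfix⟩ :=
    exists_radialGauge_vfix_at_recordCube_residual F N K hj1 hk Mc ρ hρ idx ((domainsOfSeq sq.Ω j hk).Om j) U hg ha₀' hU hcollar n5 n6 n7
  set g₁ : GaugeTransf (F.P K) 0 (SU N) := fun x => blockLift j (axialGaugeAt (Averaging.iter (avOfRecord F N K) j (GaugeField.gaugeAct ws U)) (tLo (cornerP (F.P K) Mc ρ idx) ρ) (tHi (cornerP (F.P K) Mc ρ idx) (sideP (F.P K) Mc ρ) ρ) (ctr (cornerP (F.P K) Mc ρ idx) (sideP (F.P K) Mc ρ))) x * ws x with hg₁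
  set g₂ : GaugeTransf (F.P K) 0 (SU N) := fun x => blockLift j (axialGaugeAt (Averaging.iter (avOfRecord F N K) j (GaugeField.gaugeAct wr U)) (tLo (cornerP (F.P K) Mc ρ idx) ρ) (tHi (cornerP (F.P K) Mc ρ idx) (sideP (F.P K) Mc ρ) ρ) (ctr (cornerP (F.P K) Mc ρ idx) (sideP (F.P K) Mc ρ))) x * wr x with hg₂
  have hax₁ : ∀ n, n < j → AxialGauge (symCd F N K n) (Averaging.iter (avOfRecord F N K) n (GaugeField.gaugeAct g₁ U)) := by
    intro n hn
    have hcomp : GaugeField.gaugeAct g₁ U = GaugeField.gaugeAct (blockLift j (axialGaugeAt (Averaging.iter (avOfRecord F N K) j (GaugeField.gaugeAct ws U)) (tLo (cornerP (F.P K) Mc ρ idx) ρ) (tHi (cornerP (F.P K) Mc ρ idx) (sideP (F.P K) Mc ρ) ρ) (ctr (cornerP (F.P K) Mc ρ idx) (sideP (F.P K) Mc ρ)))) (GaugeField.gaugeAct ws U) :=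
      (B16Sect1Backgrounds.gaugeAct_gaugeAct _ _ _).symm
    rw [hcomp]
    exact symTower_gaugeAct_blockLift F N K hk _ _ hax_s n hn
  -- ### the two carriers agree on `T^{(j)}` (residuality: `M^j(U^w) = M^j U`)
  have hiter_s : Averaging.iter (avOfRecord F N K) j (GaugeField.gaugeAct ws U) = Averaging.iter (avOfRecord F N K) j U :=
    iter_gaugeAct_of_isResidual (avOfRecord F N K) hk hres_s U
  have hiter_r : Averaging.iter (avOfRecord F N K) j (GaugeField.gaugeAct wr U) = Averaging.iter (avOfRecord F N K) j U :=
    iter_gaugeAct_of_isResidual (avOfRecord F N K) hk hres_r U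
  have htop : ∀ yT : Site (F.P K) j, g₁ (embIter j yT) * (g₂ (embIter j yT))⁻¹ = 1 := fun yT => by
    simp only [hg₁, hg₂, hiter_s, hiter_r, hres_s yT, hres_r yT, mul_one, mul_inv_cancel]
  -- ### the `(h, X, ω)` package (INTENT-34) at `θ := L⁻¹`, `ω_X := ω_τ`
  obtain ⟨h, hSU, hoff, hconst, -, hoscj', hosc0'⟩ := exists_junction_blockConstant_datum N c hk U g₁ g₂ hax₁ hax₂ htop hN ha₀'.le hU hcollar a ha hbud hgd haa h100
    hguard hθ0 hθ8 hωτ0 n11 n12 hE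
  have hRR0 : 0 ≤ (Cr * (((F.P K).L : ℝ) ^ 3 * ε (j - 1)) + Cω * (18 * (3840 * (((F.P K).d : ℝ) * (((F.P K).d : ℝ) + 2) * (((F.P K).d - 1 : ℕ) : ℝ) ^ 2 * ((F.P K).L : ℝ) ^ (2 * j + 2) * (ε (j - 1) * (F.P K).eta (j - 1) ^ 2))))) := by positivity
  refine ⟨h, fun j' y => uavgZ (F.P K).L (1 : Pt (F.P K).d → Fin (F.P K).d → (MatA N)ˣ) (fun x => ιSU N ((fun x' => g₁ x' * (g₂ x')⁻¹) (cover (F.P K) (x + fun _ => ((ctrShift (F.P K).L j : ℕ) : ℤ))))) j' y, 18 * (3840 * (((F.P K).d : ℝ) * (((F.P K).d : ℝ) + 2) * (((F.P K).d - 1 : ℕ) : ℝ) ^ 2 * ((F.P K).L : ℝ) ^ (2 * j + 2) * (ε (j - 1) * (F.P K).eta (j - 1) ^ 2))), hSU, hoff,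
    fun j' _ hj' y hy x hx => hconst j' hj' y hy x hx, by positivity, n16, fun j' _ z μ _ => hoscj' j' z μ, fun b _ => hosc0' b.1 b.2, fun t ht htL => ?_, n18, ?_⟩
  · -- the (152) budget row
    have hL4 : 0 ≤ ((F.P K).L : ℝ) ^ 4 := by positivity
    calc 2 * ((Cr * (((F.P K).L : ℝ) ^ 3 * ε (j - 1)) + Cω * (18 * (3840 * (((F.P K).d : ℝ) * (((F.P K).d : ℝ) + 2) * (((F.P K).d - 1 : ℕ) : ℝ) ^ 2 * ((F.P K).L : ℝ) ^ (2 * j + 2) * (ε (j - 1) * (F.P K).eta (j - 1) ^ 2))))) * t) ≤ 2 * ((Cr * (((F.P K).L : ℝ) ^ 3 * ε (j - 1)) + Cω * (18 * (3840 * (((F.P K).d : ℝ) * (((F.P K).d : ℝ) + 2) * (((F.P K).d - 1 : ℕ) : ℝ) ^ 2 * ((F.P K).L : ℝ) ^ (2 * j + 2) * (ε (j - 1) * (F.P K).eta (j - 1) ^ 2))))) * ((F.P K).L : ℝ) ^ 4) := by gcongr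
      _ < κ * ε j := n17
  -- ### THE ROW-9′ SUPPLIER
  intro u₀ hB u A hR
  obtain ⟨hu₀SU, -, hRestr, -, hlog, -, -, -, -, -, -⟩ := hB
  obtain ⟨hdoor, -, -, -, -, -, -, -, -, -⟩ := hR
  classical
  -- the glued gauge
  refine ⟨fun x => if x ∈ cover (F.P K) '' cube (F.P K).L (cornerP (F.P K) Mc ρ idx) (sideP (F.P K) Mc ρ) ρ j 0 then u x else blockLift j (axialGaugeAt (Averaging.iter (avOfRecord F N K) j (GaugeField.gaugeAct ws U)) (tLo (cornerP (F.P K) Mc ρ idx) ρ) (tHi (cornerP (F.P K) Mc ρ idx) (sideP (F.P K) Mc ρ) ρ) (ctr (cornerP (F.P K) Mc ρ idx) (sideP (F.P K) Mc ρ))) x * ws x,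
    fun x hx => if_pos hx, ?_⟩
  have hΨ0 : 0 ≤ Ψ ε j := le_trans (by positivity) n19
  refine nrmSymPhiOfRecord_glued_of_coverRow hΨ0 ws hres_s hax_s (cover (F.P K) '' cube (F.P K).L (cornerP (F.P K) Mc ρ idx) (sideP (F.P K) Mc ρ) ρ j 0)
    (fun x hx => if_pos hx) (fun x hx => if_neg hx) (fun hk' j' hj' w' hy => towers_dichotomy_image_cube_zero _ hj' w' hy) ?_
  intro hk' j' hj' w' hyLam hin
  -- ### the dented anchor of this cell
  have hcollar' : 2 ≤ j → cover (F.P K) '' tcube (F.P K).L (cornerP (F.P K) Mc ρ idx) (sideP (F.P K) Mc ρ) ρ j ⊆ sq.Ω (j - 1) := fun h2 => by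
    rw [if_neg (show j - 1 ≠ 0 by omega)] at hcollar; exact hcollar
  obtain ⟨z, hz, hzy⟩ : ∃ z : Pt (F.P K).d, z ∈ c.lamS j' ∧
      coverAt (F.P K) j' (z + fun _ => ((ctrShift (F.P K).L (j - j') : ℕ) : ℤ)) = coverAt (F.P K) j' (w' + fun _ => ((ctrShift (F.P K).L (j - j') : ℕ) : ℤ)) := by
    rcases Nat.eq_zero_or_pos j' with hj'0 | hj'1
    · -- level `0`: anchor inside `□₀ᶻ`
      subst hj'0
      have hyS := hin w' ((B8Eq119TwistedAxialRec.underZ_zero_iff (F.P K).L w' w').2 rfl)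
      obtain ⟨x₀, hx₀, hx₀eq⟩ := hyS
      have hz0 : (x₀ - fun _ => ((ctrShift (F.P K).L j : ℕ) : ℤ)) ∈ cubeZ (F.P K).L (cornerP (F.P K) Mc ρ idx) (sideP (F.P K) Mc ρ) ρ j 0 :=
        (mem_cubeZ_iff_add_ctrShift hLo (cornerP (F.P K) Mc ρ idx) (sideP (F.P K) Mc ρ) ρ (Nat.zero_le j) _).2 (by rw [sub_add_cancel]; exact hx₀)
      have hcov : cover (F.P K) ((x₀ - fun _ => ((ctrShift (F.P K).L j : ℕ) : ℤ)) + fun _ => ((ctrShift (F.P K).L j : ℕ) : ℤ)) =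
          cover (F.P K) (w' + fun _ => ((ctrShift (F.P K).L j : ℕ) : ℤ)) := by rw [sub_add_cancel]; exact hx₀eq
      have hyLam' := hyLam
      simp only [Nat.sub_zero, coverAt_zero] at hyLam'
      rw [← hcov] at hyLam'
      refine ⟨_, mem_lamS_zero_of_lamSite_meet hj1 hk hρ idx (domainsOfSeq sq.Ω j hk) hz0 hyLam' (fun h2 hb => ?_), ?_⟩
      · exact mem_domainsOfSeq_Om_of_collar F sq hk hjk hρ1 (hcollar' h2) le_rfl (by omega) hb
      · simp only [Nat.sub_zero, coverAt_zero]; exact hcov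
    · rcases Nat.lt_or_ge (j' + 1) j with hlt | hge
      · exact exists_lamS_below_of_lamSite_meet hj1 hk hρ idx (domainsOfSeq sq.Ω j hk) hj'1 hlt hyLam
          (fun hb => mem_domainsOfSeq_Om_of_collar F sq hk hjk hρ1 (hcollar' (by omega)) (by omega) (by omega) hb)
      · rcases (Nat.lt_or_ge j' j) with hlt' | hge'
        · exact exists_lamS_dent_of_lamSite_meet hj1 hk hρ idx (domainsOfSeq sq.Ω j hk) hj'1 (by omega) hyLam
        · have hjj : j' = j := le_antisymm hj' hge'
          subst hjj
          exact exists_lamS_top_of_lamSite_meet hj1 hk hρ idx (domainsOfSeq sq.Ω j' hk) hyLam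
  -- ### the inputs of ✓p760822 at the cell `z`
  have hu : ∀ x, UnderZ (F.P K).L j' z x → u₀ x ∈ unitaryUnits (MatA N) := fun x _ => specialUnitaryUnits_le_unitaryUnits (hu₀SU x)
  have hum : ∀ x, UnderZ (F.P K).L j' z x → (h⁻¹ * u₀) x ∈ unitaryUnits (MatA N) := fun x _ =>
    specialUnitaryUnits_le_unitaryUnits ((specialUnitaryUnits (Fin N)).mul_mem ((specialUnitaryUnits (Fin N)).inv_mem (hSU x)) (hu₀SU x))
  have hu1 : uavgZ (F.P K).L (1 : Pt (F.P K).d → Fin (F.P K).d → (MatA N)ˣ) u₀ j' z = 1 := uavgZ_one_eq_one_of_restr129Z hRestr hj' hz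
  -- the letter `δ_F = r·L^{−j′}` under the cell, from the crown's log rows (✓136)
  have hLj : (0 : ℝ) < ((F.P K).L : ℝ) ^ j' := by positivity
  have hFb : ∀ (x : Pt (F.P K).d) (μ : Fin (F.P K).d), UnderZ (F.P K).L j' z x → UnderZ (F.P K).L j' z (x + e μ) →
      ‖((c.fixed (fun x μ => ιSU N (U ⟨cover (F.P K) (x + fun _ => (ctrShift (F.P K).L j : ℤ)), μ⟩)) (h⁻¹ * u₀) x μ : (MatA N)ˣ) : MatA N) - 1‖ ≤ (Cr * (((F.P K).L : ℝ) ^ 3 * ε (j - 1)) + Cω * (18 * (3840 * (((F.P K).d : ℝ) * (((F.P K).d : ℝ) + 2) * (((F.P K).d - 1 : ℕ) : ℝ) ^ 2 * ((F.P K).L : ℝ) ^ (2 * j + 2) * (ε (j - 1) * (F.P K).eta (j - 1) ^ 2))))) * (((F.P K).L : ℝ) ^ j')⁻¹ := by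
    intro x μ hx _
    obtain ⟨κ', hκ'⟩ := exists_ne_dir hd2 μ
    have hside : SideTouches (c.sq j') x μ := sideTouches_of_bondTouches hκ' (Or.inl (mem_sq_of_underZ_lamS hLo c hj' hz hx))
    obtain ⟨heq, hsa, hA⟩ := hlog j' hj' ⟨x, μ⟩ hside
    exact norm_sub_one_le_of_logRow (hηpos j) heq hsa hLj hA
  -- `hptu` from the faces (INTENT-33), weakened to the uniform `ω_u`
  have hαpos : 0 < (((F.P K).L : ℝ) ^ 3 * ε (j - 1)) := by have := (hε (j - 1) (by omega)).1; positivity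
  have hptu0 := pointwise_osc_of_faces_precomposed (𝔸 := MatA N) hLs hs1 hd1 c (fun x μ => ιSU N (U ⟨cover (F.P K) (x + fun _ => (ctrShift (F.P K).L j : ℤ)), μ⟩)) (lift_mem_unitaryUnits F N U j) hαpos n8 n9 n10 hInAk hj' hz h u₀
    (hconst j' hj' z hz) hum (by positivity) hFb
  have hωu0 : 0 ≤ (3 * ((F.P K).d : ℝ) * ((((F.P K).L - 1) / 2 : ℕ) : ℝ) * ((9 * ((F.P K).d : ℝ) ^ 2 + 4 * ((F.P K).d : ℝ) * ((((F.P K).L - 1) / 2 : ℕ) : ℝ)) * (((F.P K).L : ℝ) ^ 3 * ε (j - 1))) + 2 * ((F.P K).d : ℝ) * ((((F.P K).L - 1) / 2 : ℕ) : ℝ) * (Cr * (((F.P K).L : ℝ) ^ 3 * ε (j - 1)) + Cω * (18 * (3840 * (((F.P K).d : ℝ) * (((F.P K).d : ℝ) + 2) * (((F.P K).d - 1 : ℕ) : ℝ) ^ 2 * ((F.P K).L : ℝ) ^ (2 * j + 2) * (ε (j - 1) * (F.P K).eta (j - 1) ^ 2)))))) := by positivity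
  have hptu : ∀ i, i < j' → ∀ zz, UnderZ (F.P K).L (j' - (i + 1)) z zz → ∀ w, UnderZ (F.P K).L (i + 1) zz w →
      ‖((((u₀ ((((F.P K).L : ℤ) ^ (i + 1)) • zz))⁻¹ * u₀ w : (MatA N)ˣ)) : MatA N) - 1‖ ≤ (3 * ((F.P K).d : ℝ) * ((((F.P K).L - 1) / 2 : ℕ) : ℝ) * ((9 * ((F.P K).d : ℝ) ^ 2 + 4 * ((F.P K).d : ℝ) * ((((F.P K).L - 1) / 2 : ℕ) : ℝ)) * (((F.P K).L : ℝ) ^ 3 * ε (j - 1))) + 2 * ((F.P K).d : ℝ) * ((((F.P K).L - 1) / 2 : ℕ) : ℝ) * (Cr * (((F.P K).L : ℝ) ^ 3 * ε (j - 1)) + Cω * (18 * (3840 * (((F.P K).d : ℝ) * (((F.P K).d : ℝ) + 2) * (((F.P K).d - 1 : ℕ) : ℝ) ^ 2 * ((F.P K).L : ℝ) ^ (2 * j + 2) * (ε (j - 1) * (F.P K).eta (j - 1) ^ 2)))))) * (((F.P K).L : ℝ)⁻¹) ^ (j' - (i + 1)) := by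
    intro i hi zz hzz w hw
    refine (hptu0 i hi zz hzz w hw).trans (mul_le_mul_of_nonneg_right ?_ (pow_nonneg hθ0 _))
    rw [hss]
    have hgeo : (((F.P K).L : ℝ) ^ j')⁻¹ * ((F.P K).L : ℝ) ^ (j' - 1) ≤ 1 := by
      rw [inv_mul_le_iff₀ hLj, mul_one]
      exact pow_le_pow_right₀ (by linarith) (Nat.sub_le _ _)
    have hds : 0 ≤ 2 * ((F.P K).d : ℝ) * (s₀ : ℝ) * (Cr * (((F.P K).L : ℝ) ^ 3 * ε (j - 1)) + Cω * (18 * (3840 * (((F.P K).d : ℝ) * (((F.P K).d : ℝ) + 2) * (((F.P K).d - 1 : ℕ) : ℝ) ^ 2 * ((F.P K).L : ℝ) ^ (2 * j + 2) * (ε (j - 1) * (F.P K).eta (j - 1) ^ 2))))) := by positivity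
    nlinarith [mul_le_mul_of_nonneg_left hgeo hds]
  have hguardN : ∀ i, i < j' → 4 * (3840 * (((F.P K).d : ℝ) * (((F.P K).d : ℝ) + 2) * (((F.P K).d - 1 : ℕ) : ℝ) ^ 2 * ((F.P K).L : ℝ) ^ (2 * j + 2) * (ε (j - 1) * (F.P K).eta (j - 1) ^ 2))) * (((F.P K).L : ℝ)⁻¹) ^ (j' - (i + 1)) + 4 * (3 * ((F.P K).d : ℝ) * ((((F.P K).L - 1) / 2 : ℕ) : ℝ) * ((9 * ((F.P K).d : ℝ) ^ 2 + 4 * ((F.P K).d : ℝ) * ((((F.P K).L - 1) / 2 : ℕ) : ℝ)) * (((F.P K).L : ℝ) ^ 3 * ε (j - 1))) + 2 * ((F.P K).d : ℝ) * ((((F.P K).L - 1) / 2 : ℕ) : ℝ) * (Cr * (((F.P K).L : ℝ) ^ 3 * ε (j - 1)) + Cω * (18 * (3840 * (((F.P K).d : ℝ) * (((F.P K).d : ℝ) + 2) * (((F.P K).d - 1 : ℕ) : ℝ) ^ 2 * ((F.P K).L : ℝ) ^ (2 * j + 2) * (ε (j - 1) * (F.P K).eta (j - 1) ^ 2))))))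 * (((F.P K).L : ℝ)⁻¹) ^ (j' - (i + 1)) +
      2 * (1024 * (4 * ((3840 * (((F.P K).d : ℝ) * (((F.P K).d : ℝ) + 2) * (((F.P K).d - 1 : ℕ) : ℝ) ^ 2 * ((F.P K).L : ℝ) ^ (2 * j + 2) * (ε (j - 1) * (F.P K).eta (j - 1) ^ 2))) + (3 * ((F.P K).d : ℝ) * ((((F.P K).L - 1) / 2 : ℕ) : ℝ) * ((9 * ((F.P K).d : ℝ) ^ 2 + 4 * ((F.P K).d : ℝ) * ((((F.P K).L - 1) / 2 : ℕ) : ℝ)) * (((F.P K).L : ℝ) ^ 3 * ε (j - 1))) + 2 * ((F.P K).d : ℝ) * ((((F.P K).L - 1) / 2 : ℕ) : ℝ) * (Cr * (((F.P K).L : ℝ) ^ 3 * ε (j - 1)) + Cω * (18 * (3840 * (((F.P K).d : ℝ) * (((F.P K).d : ℝ) + 2) * (((F.P K).d - 1 : ℕ) : ℝ) ^ 2 * ((F.P K).L : ℝ) ^ (2 * j + 2) * (ε (j - 1) * (F.P K).eta (j - 1) ^ 2))))))) * (((F.P K).L : ℝ)⁻¹) ^ (j' - i)) ^ 2) < deltaSU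 (Fin N) :=
    fun i _ => guardN_of_one hθ0 hθ1 hωτ0 hωu0 n15 j' i
  -- ### ✓p760822 at the cell `z`
  have hrowz := torusRow_at_recordCube_cell N c hk U g₁ g₂ hax₁ hax₂ hN ha₀'.le hU hcollar a ha hbud hgd haa h100 hguard hθ0 hθ8 hωτ0 hωu0 n13 n14 hE
    hj' hz h u₀ hu (hconst j' hj' z hz) hptu hu1 u (c.vfix (fun x μ => ιSU N (U ⟨cover (F.P K) (x + fun _ => (ctrShift (F.P K).L j : ℤ)), μ⟩))) hdoor hvfix hguardN
  -- ### the φ-row dictionary at the anchor `w′` (same torus cell)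
  have hrowz' : ‖((gaugeAvgIter (loopAvgBlockOp expMeanLogSU) (fun x => blockLift j (axialGaugeAt (Averaging.iter (avOfRecord F N K) j (GaugeField.gaugeAct ws U)) (tLo (cornerP (F.P K) Mc ρ idx) ρ) (tHi (cornerP (F.P K) Mc ρ idx) (sideP (F.P K) Mc ρ) ρ) (ctr (cornerP (F.P K) Mc ρ idx) (sideP (F.P K) Mc ρ))) x * ws x * (u x)⁻¹) j'
      (coverAt (F.P K) j' (z + fun _ => ((ctrShift (F.P K).L (j - j') : ℕ) : ℤ))) : SU N) : Matrix (Fin N) (Fin N) ℂ) - 1‖ ≤ Ψ ε j := by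
    have h1 := hrowz.trans n19
    simp only [hg₁] at h1
    exact h1
  rw [hzy] at hrowz'
  exact (norm_coe_gaugeAvgIter_sub_one_le_iff N hk' (fun x => blockLift j (axialGaugeAt (Averaging.iter (avOfRecord F N K) j (GaugeField.gaugeAct ws U)) (tLo (cornerP (F.P K) Mc ρ idx) ρ) (tHi (cornerP (F.P K) Mc ρ idx) (sideP (F.P K) Mc ρ) ρ) (ctr (cornerP (F.P K) Mc ρ idx) (sideP (F.P K) Mc ρ))) x * ws x * (u x)⁻¹) hj' w' (Ψ ε j)).2 hrowz'

end Summit.QuantumFields.YangMills.BalabanUVNodes.N07JunctionHJ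

end
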